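import Literature.AlgebraicGeometry.Motives.HodgeLieWeightOneSimple
import Literature.AlgebraicGeometry.Motives.HodgeLieWeightOnePlusPairTwinIdeal
import HarnessLib

/-!
# Weight one, `End_Hdg = ℚ`: the raising and lowering operators of `Lie Hg ⊗ ℂ` live in ONE conjugation-stable simple ideal,
# whose complement commutes with `Θ` (Deligne, LNM 900 I 3.4–3.7; Jacobson X §1)

Family `hodge`, layer `Literature/AlgebraicGeometry/Motives`; THEOREMS ONLY (no definition, no named fact; D-0026).  Sequel of
`HodgeLieWeightOneSimple` (`Lie Hg` is `ℚ`-simple for `End_Hdg = ℚ`) and `HodgeLieWeightOnePlusPairTwinIdeal` (transport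
`ℂ ⊗_ℚ Lie Hg ≃ Lie Hg ⊗ ℂ`, Jacobson's equal-dimension theorem), written for the cell `pub-hodgeav-hg6` (LADDER-HodgeAV row 2,
TABLE X rows 1 `g6.I(1)` and 8-`(4,2)`: brick N2 of the row-1 programme «`End⁰ = ℚ`, `g = 6` ⟹ `Hg = Sp₁₂`»; honest framing of
that cell: HC / HC_AV / HC_CM NOT proved — this file is unconditional Hodge–Lie linear algebra).

SETTING.  `H` effective polarized of weight `1` on `V ≠ 0` with `End_Hdg(V) = ℚ`; `𝔥 = Lie Hg(H)`, `𝔥_ℂ = hodgeLieC`; `Θ` the Hodge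
operator, `P = V^{1,0}`, `Q = V^{0,1}`; RAISING `B`: `B P = 0`, `B V_ℂ ⊆ P`; LOWERING `C`: `C Q = 0`, `C V_ℂ ⊆ Q`; `Ȳ = conj ∘ Y ∘ conj`.

RESULTS.
* §1 `WeightOneThetaIdeal.raising_eq_zero_of_commute_conjOp` — a raising `B ∈ 𝔥_ℂ` commuting with `B̄` is `0` (`BB̄ = B̄B` maps
  into `P ∩ Q = 0`, so `ψ_ℂ(Bw, conj(Bw)) = −ψ_ℂ(w, BB̄(conj w)) = 0`, Hodge–Riemann II).
* §2 `WeightOneThetaIdeal.commute_theta_of_raising_lowering_trivial` — an `ad Θ`-stable subspace without non-zero raising and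
  without non-zero lowering elements commutes with `Θ`.
* §3 **`exists_thetaIdeal_of_forall_endAlg_eq_smul`** — there are `ad 𝔥_ℂ`-stable subspaces `𝔰₁, 𝔠 ⊆ 𝔥_ℂ` with
  `𝔰₁ ⊕ 𝔠 = 𝔥_ℂ`, `[𝔰₁, 𝔠] = 0`, `𝔰₁` MINIMAL (no `ad 𝔥_ℂ`-stable subspace strictly between `0` and `𝔰₁`: a simple ideal), `𝔰₁`
  stable under `Y ↦ Ȳ`, EVERY raising and EVERY lowering operator of `𝔥_ℂ` in `𝔰₁`, and `𝔠` commuting with `Θ`; moreover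
  (Jacobson) `𝔠 = 0` or `𝔠` contains an `ad 𝔥_ℂ`-stable subspace of dimension `dim 𝔰₁`.  PROOF: `𝔥` is `ℚ`-simple
  (`isSimple_hodgeLie_of_forall_endAlg_eq_smul`), so `A = ℂ ⊗_ℚ 𝔥 ≃ 𝔥_ℂ` is semisimple and `⊤ = sSup` of its atoms; since
  `𝔥_ℂ⁺ ≠ 0` (else `𝔥_ℂ` commutes with `Θ`, `𝔥 ⊆ 𝔥 ∩ End_Hdg = 0`, `Θ = 0`, `V = 0`), some atom `S` has an element with non-zero
  raising component, which lies in `𝔰₁ = image of S` (ideals are `ad Θ`-stable).  `𝔰₁` is conjugation-stable: otherwise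
  `S ∩ conj⁻¹ 𝔰₁ = 0`, `[𝔰₁, conj 𝔰₁] = 0` and §1 kills that raising element.  With `𝔠 = image of Sᶜ`: the orthogonality lemma
  (`WeightOneSimple.raising_trivial_of_commute` with `𝔅 = 𝔰₁`, `𝔄 = 𝔠` resp. `𝔄 = conj 𝔠`) kills the raising and the lowering
  part of `𝔠`, so `𝔠` commutes with `Θ` (§2), and every raising / lowering operator `Y = s + c` equals its own raising / lowering
  component `s⁺ ∈ 𝔰₁`.  Jacobson: `exists_ideal_finrank_eq_of_isSimple_ideal`.  (Deligne: `μ` projects non-trivially to exactly one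
  simple factor of `Hg_ℂ` when `End_Hdg = ℚ`; the other factors are "compact at `h`".)  For the cell: a complex skeleton of
  `𝔥_ℂ` with two simple ideals of different dimensions (`𝔰𝔩₂ ⊕ 𝔰𝔩₃`, `𝔰𝔩₂ ⊕ 𝔰𝔭₄`, `𝔰𝔩₂ ⊕ 𝔰𝔩₄`) is thereby excluded.

## References

* [Deligne1982HodgeCycles] P. Deligne, *Hodge cycles on abelian varieties*, LNM 900 (1982), I §3 Prop. 3.4, 3.6, Example 3.7.
* [Jacobson1962LieAlgebras] N. Jacobson, *Lie Algebras* (1962), Ch. X §1, Theorems 1–3 (pp. 290–293).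
* [MoonenZarhin1999LowDim] B. Moonen, Yu. Zarhin, Math. Ann. 315 (1999), §2 (2.3), §3 (3.1).
* [Humphreys1972] J. E. Humphreys, GTM 9 (1972), §5.2.
-/

noncomputable section

open scoped TensorProduct

namespace Literature.AlgebraicGeometry.Motives

open Module Literature.Algebra.Lie

universe u

namespace HodgeStructure

variable {V : Type u} [AddCommGroup V] [Module ℚ V] [Module.Finite ℚ V] [HodgeTensorFacts.{u, u}] {n : ℤ}

/-! ## §1 A raising operator commuting with its conjugate vanishes -/

/-- **A raising `B ∈ 𝔥_ℂ` with `B B̄ = B̄ B` is zero** (`B̄ = conj ∘ B ∘ conj` is lowering, so `BB̄ = B̄B` maps `V_ℂ` into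
`P ∩ Q = 0`; then `ψ_ℂ(Bw, conj (Bw)) = ψ_ℂ(Bw, B̄ (conj w)) = −ψ_ℂ(w, BB̄(conj w)) = 0` contradicts the second Hodge–Riemann
relation unless `Bw = 0`). [cite: Deligne1982HodgeCycles, I §3 (proof of Prop. 3.4, Prop. 3.6)] [cite: MoonenZarhin1999LowDim, §2] -/
theorem WeightOneThetaIdeal.raising_eq_zero_of_commute_conjOp (H : HodgeStructure V n) (ψ : H.Polarization) (hn : n = 1)
    (heff : H.IsEffective) {Θ : Module.End ℂ (ℂ ⊗[ℚ] V)} (hΘ : ∀ p, ∀ x ∈ H.piece p (n - p), Θ x = ((2 * p - n : ℤ) : ℂ) • x)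
    {B Bb : Module.End ℂ (ℂ ⊗[ℚ] V)} (hB : B ∈ H.hodgeLieC) (hBP : ∀ p ∈ H.piece 1 0, B p = 0)
    (hBim : ∀ v, B v ∈ H.piece 1 0) (hBb : ∀ v, Bb v = conj (B (conj v))) (hcomm : B * Bb = Bb * B) : B = 0 := by
  subst hn
  obtain ⟨-, -, hΘ10, hΘ01, -⟩ := UnitaryTheta.theta_facts H rfl heff hΘ
  have hPQ0 : ∀ x, x ∈ H.piece 1 0 → x ∈ H.piece 0 1 → x = 0 := fun x hP hQ => by
    have h1 := hΘ10 x hP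
    rw [hΘ01 x hQ] at h1
    have h2 : (2 : ℂ) • x = 0 := by rw [two_smul]; nth_rewrite 1 [← h1]; rw [neg_add_cancel]
    exact (smul_eq_zero.1 h2).resolve_left (two_ne_zero' ℂ)
  have hBBb : ∀ u, B (Bb u) = 0 := fun u => by
    have h := LinearMap.congr_fun hcomm u
    rw [Module.End.mul_apply, Module.End.mul_apply] at h
    refine hPQ0 _ (hBim _) ?_
    rw [h, hBb]
    exact conj_mem_piece H (hBim _)
  refine LinearMap.ext fun w => ?_
  rw [LinearMap.zero_apply]
  by_contra hne
  obtain ⟨r, hr, hre⟩ := ψ.pos 1 0 (by norm_num) (B w) (hBim w) hne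
  have hconj : conj (B w) = Bb (conj w) := by rw [hBb, conj_conj]
  rw [hconj, formBaseChange_skew_of_mem_hodgeLieC ψ hB w (Bb (conj w)), hBBb, map_zero, neg_zero, mul_zero] at hre
  have hr0 : (r : ℂ) = 0 := hre.symm
  exact hr.ne' (by exact_mod_cast hr0)

/-! ## §2 No raising and no lowering elements ⟹ commutes with `Θ` -/

omit [Module.Finite ℚ V] [HodgeTensorFacts.{u, u}] in
/-- **An `ad Θ`-stable subspace all of whose raising and lowering elements vanish commutes with `Θ`** (weight one:
`Y = Y⁺ + Y⁻ + ½(Y + ΘYΘ)` with `Y⁺`, `Y⁻ ∈ 𝔅` raising, lowering). [cite: Deligne1982HodgeCycles, I §3 (proof of Prop. 3.4)] -/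
theorem WeightOneThetaIdeal.commute_theta_of_raising_lowering_trivial (H : HodgeStructure V n) (hn : n = 1)
    (heff : H.IsEffective) {Θ : Module.End ℂ (ℂ ⊗[ℚ] V)} (hΘ : ∀ p, ∀ x ∈ H.piece p (n - p), Θ x = ((2 * p - n : ℤ) : ℂ) • x)
    {𝔅 : Submodule ℂ (Module.End ℂ (ℂ ⊗[ℚ] V))} (had : ∀ Z ∈ 𝔅, Θ * Z - Z * Θ ∈ 𝔅)
    (h0 : ∀ B ∈ 𝔅, (∀ p ∈ H.piece 1 0, B p = 0) → (∀ v, B v ∈ H.piece 1 0) → B = 0)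
    (h0' : ∀ C ∈ 𝔅, (∀ q ∈ H.piece 0 1, C q = 0) → (∀ v, C v ∈ H.piece 0 1) → C = 0) :
    ∀ Y ∈ 𝔅, Θ * Y = Y * Θ := by
  subst hn
  obtain ⟨hPmem, hQmem, hΘ10, hΘ01, hΘΘ⟩ := UnitaryTheta.theta_facts H rfl heff hΘ
  have hTfix : ∀ x : ℂ ⊗[ℚ] V, Θ x = x → x ∈ H.piece 1 0 := fun x hx => by
    have h := hPmem x
    rwa [hx, ← two_smul ℂ x, smul_smul, inv_mul_cancel₀ (two_ne_zero' ℂ), one_smul] at h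
  have hTneg : ∀ x : ℂ ⊗[ℚ] V, Θ x = -x → x ∈ H.piece 0 1 := fun x hx => by
    have h := hQmem x
    rwa [hx, sub_neg_eq_add, ← two_smul ℂ x, smul_smul, inv_mul_cancel₀ (two_ne_zero' ℂ), one_smul] at h
  intro Y hY
  have hR0 := h0 _ (PlusLineSimple.raise_mem_of_ad_stable had hΘΘ hY)
    (fun p hp => UnitaryTheta.raise_apply_of_eq Θ Y (hΘ10 p hp)) (fun v => hTfix _ (UnitaryTheta.apply_raise_apply hΘΘ Y v))
  have had' : ∀ Z ∈ 𝔅, (-Θ) * Z - Z * (-Θ) ∈ 𝔅 := fun Z hZ => by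
    have h : (-Θ) * Z - Z * (-Θ) = -(Θ * Z - Z * Θ) := LinearMap.ext fun v => by
      simp only [LinearMap.sub_apply, Module.End.mul_apply, LinearMap.neg_apply, map_neg]; abel
    rw [h]; exact Submodule.neg_mem _ (had Z hZ)
  have hΘΘ' : ∀ v, (-Θ) ((-Θ) v) = v := fun v => by rw [LinearMap.neg_apply, LinearMap.neg_apply, map_neg, neg_neg, hΘΘ]
  have hL0 := h0' _ (PlusLineSimple.raise_mem_of_ad_stable had' hΘΘ' hY)
    (fun q hq => UnitaryTheta.raise_apply_of_eq (-Θ) Y (by rw [LinearMap.neg_apply, hΘ01 q hq, neg_neg]))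
    (fun v => hTneg _ (by
      have h := UnitaryTheta.apply_raise_apply hΘΘ' Y v
      rw [LinearMap.neg_apply, neg_eq_iff_eq_neg] at h
      exact h))
  have hΘ2 : Θ * Θ = 1 := LinearMap.ext fun v => by rw [Module.End.mul_apply, hΘΘ, Module.End.one_apply]
  have h1 : (-Θ) * Y = -(Θ * Y) := LinearMap.ext fun v => by simp only [Module.End.mul_apply, LinearMap.neg_apply]
  have h2 : Y * (-Θ) = -(Y * Θ) := LinearMap.ext fun v => by simp only [Module.End.mul_apply, LinearMap.neg_apply, map_neg]
  have h3 : (-Θ) * Y * (-Θ) = Θ * Y * Θ := LinearMap.ext fun v => by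
    simp only [Module.End.mul_apply, LinearMap.neg_apply, map_neg, neg_neg]
  have hsum : (4 : ℂ)⁻¹ • (Y + Θ * Y - Y * Θ - Θ * Y * Θ) + (4 : ℂ)⁻¹ • (Y + (-Θ) * Y - Y * (-Θ) - (-Θ) * Y * (-Θ)) =
      (2 : ℂ)⁻¹ • (Y - Θ * Y * Θ) := by
    rw [h3, h1, h2]; module
  rw [hR0, hL0, add_zero] at hsum
  have hYe : Y = Θ * Y * Θ := by
    have h : (2 : ℂ)⁻¹ • (Y - Θ * Y * Θ) = 0 := hsum.symm
    rw [smul_eq_zero] at h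
    rcases h with h | h
    · exact absurd h (inv_ne_zero (two_ne_zero' ℂ))
    · exact sub_eq_zero.1 h
  calc Θ * Y = Θ * (Θ * Y * Θ) := by rw [← hYe]
    _ = (Θ * Θ) * Y * Θ := by noncomm_ring
    _ = Y * Θ := by rw [hΘ2, one_mul]

/-! ## §3 The `Θ`-ideal: one conjugation-stable simple ideal carries all raising and lowering operators -/

set_option maxHeartbeats 1600000 in
/-- **The `Θ`-ideal of `Lie Hg ⊗ ℂ` for `End_Hdg = ℚ`** (weight one, `V ≠ 0`).  There are `ad 𝔥_ℂ`-stable subspaces `𝔰₁`, `𝔠` of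
`𝔥_ℂ` with `𝔰₁ ∩ 𝔠 = 0`, `𝔰₁ + 𝔠 = 𝔥_ℂ`, `[𝔰₁, 𝔠] = 0`, `𝔰₁ ≠ 0` MINIMAL among non-zero `ad 𝔥_ℂ`-stable subspaces (a simple ideal),
`𝔰₁` stable under `Y ↦ conj ∘ Y ∘ conj`, containing EVERY raising and EVERY lowering operator of `𝔥_ℂ`, and `𝔠` commuting with
`Θ`; and (Jacobson) either `𝔠 = 0` or `𝔠` contains a non-zero `ad 𝔥_ℂ`-stable subspace of dimension `dim 𝔰₁`.
[cite: Deligne1982HodgeCycles, I §3 Prop. 3.4, Prop. 3.6, Example 3.7] [cite: Jacobson1962LieAlgebras, Ch. X §1 Theorems 1–3]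
[cite: MoonenZarhin1999LowDim, §3 (3.1)] [cite: Humphreys1972, §5.2] -/
theorem exists_thetaIdeal_of_forall_endAlg_eq_smul [Nontrivial V] (H : HodgeStructure V n) (ψ : H.Polarization)
    (hn : n = 1) (heff : H.IsEffective) (hE : ∀ a ∈ H.endAlg, ∃ x : ℚ, a = x • 1) {Θ : Module.End ℂ (ℂ ⊗[ℚ] V)}
    (hΘ : ∀ p, ∀ x ∈ H.piece p (n - p), Θ x = ((2 * p - n : ℤ) : ℂ) • x) :
    ∃ 𝔰₁ 𝔠 : Submodule ℂ (Module.End ℂ (ℂ ⊗[ℚ] V)), 𝔰₁ ≤ H.hodgeLieC ∧ 𝔠 ≤ H.hodgeLieC ∧ 𝔰₁ ⊓ 𝔠 = ⊥ ∧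
      𝔰₁ ⊔ 𝔠 = H.hodgeLieC ∧ (∀ Y ∈ H.hodgeLieC, ∀ s ∈ 𝔰₁, Y * s - s * Y ∈ 𝔰₁) ∧
      (∀ Y ∈ H.hodgeLieC, ∀ c ∈ 𝔠, Y * c - c * Y ∈ 𝔠) ∧ (∀ s ∈ 𝔰₁, ∀ c ∈ 𝔠, s * c = c * s) ∧ 𝔰₁ ≠ ⊥ ∧
      (∀ T : Submodule ℂ (Module.End ℂ (ℂ ⊗[ℚ] V)), T ≤ 𝔰₁ → T ≠ ⊥ → (∀ Y ∈ H.hodgeLieC, ∀ t ∈ T, Y * t - t * Y ∈ T) → T = 𝔰₁) ∧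
      (∀ s ∈ 𝔰₁, ∀ s' : Module.End ℂ (ℂ ⊗[ℚ] V), (∀ v, s' v = conj (s (conj v))) → s' ∈ 𝔰₁) ∧
      (∀ B ∈ H.hodgeLieC, (∀ p ∈ H.piece 1 0, B p = 0) → (∀ v, B v ∈ H.piece 1 0) → B ∈ 𝔰₁) ∧
      (∀ C ∈ H.hodgeLieC, (∀ q ∈ H.piece 0 1, C q = 0) → (∀ v, C v ∈ H.piece 0 1) → C ∈ 𝔰₁) ∧
      (∀ c ∈ 𝔠, Θ * c = c * Θ) ∧
      (𝔠 = ⊥ ∨ ∃ W : Submodule ℂ (Module.End ℂ (ℂ ⊗[ℚ] V)), W ≤ 𝔠 ∧ W ≠ ⊥ ∧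
        (∀ Y ∈ H.hodgeLieC, ∀ w ∈ W, Y * w - w * Y ∈ W) ∧ Module.finrank ℂ W = Module.finrank ℂ 𝔰₁) := by
  classical
  letI iQ : LieRing (Module.End ℚ V) := LieRing.ofAssociativeRing
  letI iC : LieRing (Module.End ℂ (ℂ ⊗[ℚ] V)) := LieRing.ofAssociativeRing
  have hz := hodgeLie_inf_endAlg_eq_bot_of_forall_endAlg_eq_smul H ψ hE
  have horth := fun (𝔄 𝔅 : Submodule ℂ (Module.End ℂ (ℂ ⊗[ℚ] V))) =>
    WeightOneSimple.raising_trivial_of_commute H ψ hn heff hE hΘ (𝔄 := 𝔄) (𝔅 := 𝔅)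
  have hkill := fun {B Bb : Module.End ℂ (ℂ ⊗[ℚ] V)} (hB : B ∈ H.hodgeLieC) =>
    WeightOneThetaIdeal.raising_eq_zero_of_commute_conjOp H ψ hn heff hΘ (B := B) (Bb := Bb) hB
  have hcommΘ := fun (𝔅 : Submodule ℂ (Module.End ℂ (ℂ ⊗[ℚ] V))) =>
    WeightOneThetaIdeal.commute_theta_of_raising_lowering_trivial H hn heff hΘ (𝔅 := 𝔅)
  -- the rational Lie algebra `𝔏 = Lie Hg` (simple) and the complex one `𝔏'` with carrier `𝔥_ℂ`
  obtain ⟨𝔏, h𝔏⟩ := exists_lieSubalgebra_eq_hodgeLie H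
  obtain ⟨𝔏', h𝔏'⟩ := exists_lieSubalgebra_eq_hodgeLieC H
  haveI hsimple : LieAlgebra.IsSimple ℚ 𝔏 := isSimple_hodgeLie_of_forall_endAlg_eq_smul H ψ hn heff hE 𝔏 h𝔏
  subst hn
  obtain ⟨hPmem, hQmem, hΘ10, hΘ01, hΘΘ⟩ := UnitaryTheta.theta_facts H rfl heff hΘ
  have hΘM : Θ ∈ H.hodgeLieC := H.mem_hodgeLieC_of_forall_piece hΘ
  have hmem𝔏' : ∀ {x}, x ∈ 𝔏' ↔ x ∈ H.hodgeLieC := fun {x} => by rw [← LieSubalgebra.mem_toSubmodule, h𝔏']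
  haveI : Module.Finite ℚ 𝔏 := Module.Finite.of_injective 𝔏.toSubmodule.subtype Subtype.val_injective
  have hspan : 𝔏'.toSubmodule = spanC 𝔏.toSubmodule := by rw [h𝔏', h𝔏, hodgeLieC_eq_spanC]
  obtain ⟨e, -⟩ := exists_lieEquiv_baseChange_spanC 𝔏 𝔏' hspan
  haveI hss : LieAlgebra.IsSemisimple ℂ (ℂ ⊗[ℚ] 𝔏) :=
    KillingBaseChange.isSemisimple_baseChange (k := ℚ) (K := ℂ) (L := 𝔏)
  -- `Φ = val ∘ e : ℂ ⊗ 𝔏 → End(V_ℂ)`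
  let Φ : ℂ ⊗[ℚ] 𝔏 →ₗ[ℂ] Module.End ℂ (ℂ ⊗[ℚ] V) :=
    𝔏'.toSubmodule.subtype ∘ₗ ((e : ℂ ⊗[ℚ] 𝔏 →ₗ⁅ℂ⁆ 𝔏') : ℂ ⊗[ℚ] 𝔏 →ₗ[ℂ] 𝔏')
  have hΦ : ∀ y, Φ y = ((e y : 𝔏') : Module.End ℂ (ℂ ⊗[ℚ] V)) := fun y => rfl
  have hΦinj : Function.Injective Φ := fun y z h => e.injective (Subtype.ext (by exact h))
  have hΦmem : ∀ y, Φ y ∈ H.hodgeLieC := fun y => hmem𝔏'.1 (e y).2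
  have hΦsurj : ∀ Y ∈ H.hodgeLieC, ∃ y, Φ y = Y := fun Y hY =>
    ⟨e.symm ⟨Y, hmem𝔏'.2 hY⟩, by rw [hΦ, LieEquiv.apply_symm_apply]⟩
  have hΦlie : ∀ y z : ℂ ⊗[ℚ] 𝔏, Φ ⁅y, z⁆ = Φ y * Φ z - Φ z * Φ y := fun y z => by
    rw [hΦ, hΦ, hΦ, e.map_lie, LieSubalgebra.coe_bracket, LieRing.of_associative_ring_bracket]
  -- images of ideals are `ad 𝔥_ℂ`-stable; disjoint ideals give commuting images; dimensions; images of `⊥`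
  have hst : ∀ I : LieIdeal ℂ (ℂ ⊗[ℚ] 𝔏), ∀ Y ∈ H.hodgeLieC, ∀ j ∈ I.toSubmodule.map Φ,
      Y * j - j * Y ∈ I.toSubmodule.map Φ := by
    rintro I Y hY _ ⟨i, hi, rfl⟩
    obtain ⟨y, rfl⟩ := hΦsurj Y hY
    exact ⟨⁅y, i⁆, I.lie_mem hi, hΦlie y i⟩
  have hcomm0 : ∀ I I' : LieIdeal ℂ (ℂ ⊗[ℚ] 𝔏), I ⊓ I' = ⊥ → ∀ i ∈ I, ∀ j ∈ I', Φ i * Φ j = Φ j * Φ i := by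
    intro I I' hII' i hi j hj
    have h1 : ⁅i, j⁆ ∈ I' := I'.lie_mem hj
    have h2 : ⁅i, j⁆ ∈ I := by rw [← lie_skew]; exact neg_mem (I.lie_mem hi)
    have h0 : ⁅i, j⁆ = 0 := by
      have h : ⁅i, j⁆ ∈ I ⊓ I' := (LieSubmodule.mem_inf _ _ _).2 ⟨h2, h1⟩
      rwa [hII', LieSubmodule.mem_bot] at h
    rw [← sub_eq_zero, ← hΦlie, h0, map_zero]
  have hfin : ∀ I : LieIdeal ℂ (ℂ ⊗[ℚ] 𝔏),
      Module.finrank ℂ (I.toSubmodule.map Φ) = Module.finrank ℂ I.toSubmodule := fun I =>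
    (Submodule.equivMapOfInjective Φ hΦinj I.toSubmodule).finrank_eq.symm
  have hmaple : ∀ I : LieIdeal ℂ (ℂ ⊗[ℚ] 𝔏), I.toSubmodule.map Φ ≤ H.hodgeLieC := by
    rintro I _ ⟨i, -, rfl⟩; exact hΦmem i
  have hmap0 : ∀ I : LieIdeal ℂ (ℂ ⊗[ℚ] 𝔏), I.toSubmodule.map Φ = ⊥ → I = ⊥ := by
    intro I hI
    rw [eq_bot_iff]
    intro i hi
    rw [LieSubmodule.mem_bot]
    apply hΦinj
    rw [map_zero]
    have h : Φ i ∈ I.toSubmodule.map Φ := ⟨i, hi, rfl⟩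
    rwa [hI, Submodule.mem_bot] at h
  -- the Lie ideal of `ℂ ⊗ 𝔏` over an `ad 𝔥_ℂ`-stable subspace of `𝔥_ℂ`
  have hpull : ∀ 𝔱 : Submodule ℂ (Module.End ℂ (ℂ ⊗[ℚ] V)), 𝔱 ≤ H.hodgeLieC →
      (∀ Y ∈ H.hodgeLieC, ∀ t ∈ 𝔱, Y * t - t * Y ∈ 𝔱) →
      ∃ T : LieIdeal ℂ (ℂ ⊗[ℚ] 𝔏), T.toSubmodule.map Φ = 𝔱 := by
    intro 𝔱 h𝔱 h𝔱st
    let 𝔱' : LieIdeal ℂ 𝔏' :=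
      { (𝔱.comap 𝔏'.toSubmodule.subtype) with
        lie_mem := fun {x m} hm => by
          change ((⁅x, m⁆ : 𝔏') : Module.End ℂ (ℂ ⊗[ℚ] V)) ∈ 𝔱
          rw [LieSubalgebra.coe_bracket, LieRing.of_associative_ring_bracket]
          exact h𝔱st _ (hmem𝔏'.1 x.2) _ hm }
    have hmem𝔱' : ∀ x : 𝔏', x ∈ 𝔱' ↔ (x : Module.End ℂ (ℂ ⊗[ℚ] V)) ∈ 𝔱 := fun x => Iff.rfl
    refine ⟨𝔱'.comap (e : ℂ ⊗[ℚ] 𝔏 →ₗ⁅ℂ⁆ 𝔏'), le_antisymm ?_ fun x hx => ?_⟩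
    · rintro _ ⟨y, hy, rfl⟩
      rw [SetLike.mem_coe, LieSubmodule.mem_toSubmodule, LieIdeal.mem_comap] at hy
      exact (hmem𝔱' _).1 hy
    · obtain ⟨y, rfl⟩ := hΦsurj x (h𝔱 hx)
      refine ⟨y, ?_, rfl⟩
      rw [SetLike.mem_coe, LieSubmodule.mem_toSubmodule, LieIdeal.mem_comap]
      exact (hmem𝔱' _).2 hx
  -- raising components and the conjugate image of a subspace
  set π : Module.End ℂ (ℂ ⊗[ℚ] V) →ₗ[ℂ] Module.End ℂ (ℂ ⊗[ℚ] V) :=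
    (4 : ℂ)⁻¹ • (LinearMap.id + LinearMap.mulLeft ℂ Θ - LinearMap.mulRight ℂ Θ -
      (LinearMap.mulLeft ℂ Θ).comp (LinearMap.mulRight ℂ Θ)) with hπdef
  have hπ : ∀ Y, π Y = (4 : ℂ)⁻¹ • (Y + Θ * Y - Y * Θ - Θ * Y * Θ) := fun Y => by
    simp only [hπdef, LinearMap.smul_apply, LinearMap.sub_apply, LinearMap.add_apply, LinearMap.id_apply,
      LinearMap.mulLeft_apply, LinearMap.mulRight_apply, LinearMap.comp_apply, mul_assoc]
  have hTfix : ∀ x : ℂ ⊗[ℚ] V, Θ x = x → x ∈ H.piece 1 0 := fun x hx => by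
    have h := hPmem x
    rwa [hx, ← two_smul ℂ x, smul_smul, inv_mul_cancel₀ (two_ne_zero' ℂ), one_smul] at h
  have hπP : ∀ Y, ∀ p ∈ H.piece 1 0, π Y p = 0 := fun Y p hp => by
    rw [hπ]; exact UnitaryTheta.raise_apply_of_eq Θ Y (hΘ10 p hp)
  have hπim : ∀ Y v, π Y v ∈ H.piece 1 0 := fun Y v => by
    rw [hπ]; exact hTfix _ (UnitaryTheta.apply_raise_apply hΘΘ Y v)
  have hPQv : ∀ v : ℂ ⊗[ℚ] V, (2 : ℂ)⁻¹ • (v + Θ v) + (2 : ℂ)⁻¹ • (v - Θ v) = v := fun v => by module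
  have hext : ∀ Y Y' : Module.End ℂ (ℂ ⊗[ℚ] V), (∀ p ∈ H.piece 1 0, Y p = Y' p) →
      (∀ q ∈ H.piece 0 1, Y q = Y' q) → Y = Y' := fun Y Y' h1 h2 =>
    LinearMap.ext fun v => by rw [← hPQv v, map_add, map_add, h1 _ (hPmem v), h2 _ (hQmem v)]
  have hπraise : ∀ B : Module.End ℂ (ℂ ⊗[ℚ] V), (∀ p ∈ H.piece 1 0, B p = 0) → (∀ v, B v ∈ H.piece 1 0) → π B = B :=
    fun B hBP hBim => hext _ _ (fun p hp => by rw [hπP B p hp, hBP p hp])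
      (fun q hq => by rw [hπ, UnitaryTheta.raise_apply_of_eq_neg Θ B (hΘ01 q hq), hΘ10 _ (hBim q)]; module)
  have hπmem : ∀ I : LieIdeal ℂ (ℂ ⊗[ℚ] 𝔏), ∀ Y ∈ I.toSubmodule.map Φ, π Y ∈ I.toSubmodule.map Φ := fun I Y hY => by
    rw [hπ]; exact PlusLineSimple.raise_mem_of_ad_stable (fun Z hZ => hst I Θ hΘM Z hZ) hΘΘ hY
  -- `𝔥_ℂ` has a non-zero raising element: otherwise `𝔥_ℂ` commutes with `Θ`, `𝔥 = 0`, `Θ = 0`, `V = 0`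
  have hraise : ∃ Y ∈ H.hodgeLieC, π Y ≠ 0 := by
    by_contra hno
    push Not at hno
    have h0 : ∀ B ∈ H.hodgeLieC, (∀ p ∈ H.piece 1 0, B p = 0) → (∀ v, B v ∈ H.piece 1 0) → B = 0 :=
      fun B hB hBP hBim => by rw [← hπraise B hBP hBim]; exact hno B hB
    have hconjM : ∀ B ∈ H.hodgeLieC, ∀ C : Module.End ℂ (ℂ ⊗[ℚ] V), (∀ v, C v = conj (B (conj v))) → C ∈ H.hodgeLieC :=
      fun B hB C hC => by rw [hodgeLieC_eq_spanC] at hB ⊢; exact conjOp_mem_spanC hB hC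
    have hcomm := WeightOneSimple.commute_theta_of_raising_trivial H rfl heff hΘ
      (fun Z hZ => H.commutator_mem_hodgeLieC hΘM hZ) hconjM h0
    have hC0 : H.hodgeLieC ≤ ⊥ := by
      rw [hodgeLieC_eq_spanC]
      refine Submodule.span_le.2 ?_
      rintro _ ⟨X, hX, rfl⟩
      have hXE : X ∈ H.endAlg :=
        mem_endAlg_of_commute_theta H hΘ (hcomm _ (H.baseChange_mem_hodgeLieC hX)).symm
      have hX0 : X ∈ H.hodgeLie ⊓ Subalgebra.toSubmodule H.endAlg := Submodule.mem_inf.2 ⟨hX, hXE⟩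
      rw [hz, Submodule.mem_bot] at hX0
      change X.baseChange ℂ ∈ (⊥ : Submodule ℂ (Module.End ℂ (ℂ ⊗[ℚ] V)))
      rw [hX0, LinearMap.baseChange_zero]
      exact Submodule.zero_mem _
    have hΘ0 : Θ = 0 := (Submodule.mem_bot ℂ).1 (hC0 hΘM)
    haveI : Nontrivial (ℂ ⊗[ℚ] V) := Module.nontrivial_of_finrank_pos (R := ℂ)
      (by rw [Module.finrank_baseChange]; exact Module.finrank_pos)
    obtain ⟨w, hw⟩ := exists_ne (0 : ℂ ⊗[ℚ] V)
    have hp0 : ∀ p ∈ H.piece 1 0, p = 0 := fun p hp => by rw [← hΘ10 p hp, hΘ0, LinearMap.zero_apply]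
    have hq0 : ∀ q ∈ H.piece 0 1, q = 0 := fun q hq => by
      have h := hΘ01 q hq
      rw [hΘ0, LinearMap.zero_apply] at h
      exact neg_eq_zero.1 h.symm
    exact hw (by rw [← hPQv w, hp0 _ (hPmem _), hq0 _ (hQmem _), add_zero])
  -- an atom `S` whose image has a non-zero raising element
  obtain ⟨S, hSatom, s₀, hs₀S, hπs₀⟩ : ∃ S : LieIdeal ℂ (ℂ ⊗[ℚ] 𝔏), IsAtom S ∧ ∃ s₀ ∈ S, π (Φ s₀) ≠ 0 := by
    by_contra hno
    push Not at hno
    have hker : ∀ S : LieIdeal ℂ (ℂ ⊗[ℚ] 𝔏), IsAtom S → S.toSubmodule ≤ LinearMap.ker (π ∘ₗ Φ) :=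
      fun S hS s hs => by rw [LinearMap.mem_ker, LinearMap.comp_apply]; exact hno S hS s hs
    have htop : (⊤ : LieIdeal ℂ (ℂ ⊗[ℚ] 𝔏)).toSubmodule ≤ LinearMap.ker (π ∘ₗ Φ) := by
      rw [← LieAlgebra.IsSemisimple.sSup_atoms_eq_top, LieSubmodule.sSup_toSubmodule]
      exact sSup_le fun s ⟨S, hS, hs⟩ => hs ▸ hker S hS
    obtain ⟨Y, hY, hπY⟩ := hraise
    obtain ⟨y, rfl⟩ := hΦsurj Y hY
    have h := htop (show y ∈ (⊤ : LieIdeal ℂ (ℂ ⊗[ℚ] 𝔏)).toSubmodule from trivial)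
    rw [LinearMap.mem_ker, LinearMap.comp_apply] at h
    exact hπY h
  haveI hSsimple : LieAlgebra.IsSimple ℂ S := LieAlgebra.IsSemisimple.isSimple_of_isAtom S hSatom
  set 𝔰₁ := S.toSubmodule.map Φ with h𝔰₁
  set 𝔠 := (Sᶜ).toSubmodule.map Φ with h𝔠
  have hB₁mem : π (Φ s₀) ∈ 𝔰₁ := hπmem S _ ⟨s₀, hs₀S, rfl⟩
  -- minimality of `𝔰₁`
  have hmin : ∀ T : Submodule ℂ (Module.End ℂ (ℂ ⊗[ℚ] V)), T ≤ 𝔰₁ → T ≠ ⊥ →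
      (∀ Y ∈ H.hodgeLieC, ∀ t ∈ T, Y * t - t * Y ∈ T) → T = 𝔰₁ := by
    intro T hT hT0 hTst
    obtain ⟨T', hT'⟩ := hpull T (hT.trans (hmaple S)) hTst
    have hT'S : T' ≤ S := by
      intro y hy
      have h : Φ y ∈ 𝔰₁ := hT (hT' ▸ ⟨y, hy, rfl⟩)
      obtain ⟨s, hs, hsy⟩ := h
      rw [← hΦinj hsy]; exact hs
    have hT'0 : T' ≠ ⊥ := fun h => hT0 (by rw [← hT', h]; simp)
    rcases hSatom.le_iff.1 hT'S with h | h
    · exact absurd h hT'0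
    · rw [← hT', h]
  -- `𝔰₁` is conjugation-stable
  obtain ⟨𝔰₁b, h𝔰₁b⟩ : ∃ T : Submodule ℂ (Module.End ℂ (ℂ ⊗[ℚ] V)),
      ∀ C, C ∈ T ↔ ∃ B ∈ 𝔰₁, ∀ v, C v = conj (B (conj v)) := by
    refine ⟨{ carrier := {C | ∃ B ∈ 𝔰₁, ∀ v, C v = conj (B (conj v))}
              zero_mem' := ⟨0, Submodule.zero_mem _, fun v => by simp⟩
              add_mem' := ?_, smul_mem' := ?_ }, fun C => Iff.rfl⟩
    · rintro C C' ⟨B, hB, hC⟩ ⟨B', hB', hC'⟩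
      exact ⟨B + B', Submodule.add_mem _ hB hB', fun v => by
        rw [LinearMap.add_apply, hC, hC', LinearMap.add_apply, map_add]⟩
    · rintro c C ⟨B, hB, hC⟩
      exact ⟨(starRingEnd ℂ c) • B, Submodule.smul_mem _ _ hB, fun v => by
        rw [LinearMap.smul_apply, hC, LinearMap.smul_apply, conj_smul, starRingEnd_self_apply]⟩
  have hconj_invol : ∀ {B C D : Module.End ℂ (ℂ ⊗[ℚ] V)}, (∀ v, C v = conj (B (conj v))) →
      (∀ v, D v = conj (C (conj v))) → D = B := fun {B C D} hC hD => LinearMap.ext fun v => by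
    rw [hD, hC, conj_conj, conj_conj]
  have hconj_mul : ∀ {Y Z Yb Zb : Module.End ℂ (ℂ ⊗[ℚ] V)}, (∀ v, Yb v = conj (Y (conj v))) →
      (∀ v, Zb v = conj (Z (conj v))) → ∀ v, conj ((Y * Z) (conj v)) = (Yb * Zb) v := fun {Y Z Yb Zb} hYb hZb v => by
    rw [Module.End.mul_apply, Module.End.mul_apply, hYb, hZb, conj_conj]
  have h𝔰₁ble : 𝔰₁b ≤ H.hodgeLieC := fun C hC => by
    obtain ⟨B, hB, hCB⟩ := (h𝔰₁b C).1 hC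
    have hB' : B ∈ H.hodgeLieC := hmaple S hB
    rw [hodgeLieC_eq_spanC] at hB' ⊢
    exact conjOp_mem_spanC hB' hCB
  have h𝔰₁bst : ∀ Y ∈ H.hodgeLieC, ∀ t ∈ 𝔰₁b, Y * t - t * Y ∈ 𝔰₁b := by
    intro Y hY C hC
    obtain ⟨B, hB, hCB⟩ := (h𝔰₁b C).1 hC
    obtain ⟨Yb, hYb⟩ := exists_conjOp Y
    have hYbM : Yb ∈ H.hodgeLieC := by rw [hodgeLieC_eq_spanC] at hY ⊢; exact conjOp_mem_spanC hY hYb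
    refine (h𝔰₁b _).2 ⟨Yb * B - B * Yb, hst S Yb hYbM B hB, fun v => ?_⟩
    have hYbb : ∀ v, Y v = conj (Yb (conj v)) := fun v => by rw [hYb, conj_conj, conj_conj]
    rw [LinearMap.sub_apply, LinearMap.sub_apply, map_sub, ← hconj_mul hYbb hCB, ← hconj_mul hCB hYbb]
  have h𝔰₁conj : ∀ s ∈ 𝔰₁, ∀ s' : Module.End ℂ (ℂ ⊗[ℚ] V), (∀ v, s' v = conj (s (conj v))) → s' ∈ 𝔰₁ := by
    obtain ⟨T, hT⟩ := hpull 𝔰₁b h𝔰₁ble h𝔰₁bst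
    -- `S ⊓ T = ⊥` would make `[𝔰₁, conj 𝔰₁] = 0` and kill the raising element `π (Φ s₀)`
    have hST : ¬ S ⊓ T = ⊥ := by
      intro hST
      obtain ⟨Bb, hBb⟩ := exists_conjOp (π (Φ s₀))
      have hmem1 : π (Φ s₀) ∈ H.hodgeLieC := hmaple S hB₁mem
      have hBbT : Bb ∈ T.toSubmodule.map Φ := by rw [hT]; exact (h𝔰₁b _).2 ⟨_, hB₁mem, hBb⟩
      obtain ⟨s, hs, hseq⟩ := hB₁mem
      obtain ⟨t, ht, hteq⟩ := hBbT
      have hc : π (Φ s₀) * Bb = Bb * π (Φ s₀) := by rw [← hseq, ← hteq]; exact hcomm0 S T hST s hs t ht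
      exact hπs₀ (hkill hmem1 (hπP _) (hπim _) hBb hc)
    have hSleT : S ≤ T := by
      rcases hSatom.le_iff.1 (inf_le_left : S ⊓ T ≤ S) with h | h
      · exact absurd h hST
      · exact h ▸ inf_le_right
    -- `𝔰₁ ≤ conj 𝔰₁`, hence `conj 𝔰₁ ≤ conj conj 𝔰₁ = 𝔰₁`
    have hle : 𝔰₁ ≤ 𝔰₁b := by
      rw [← hT]
      rintro _ ⟨y, hy, rfl⟩
      exact ⟨y, hSleT hy, rfl⟩
    intro s hs s' hs'
    obtain ⟨B, hB, hsB⟩ := (h𝔰₁b s).1 (hle hs)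
    have h : s' = B := hconj_invol hsB hs'
    rw [h]; exact hB
  -- the complement has no raising and no lowering elements
  have hSC : S ⊓ Sᶜ = ⊥ := inf_compl_eq_bot
  have hcomm𝔰𝔠 : ∀ s ∈ 𝔰₁, ∀ c ∈ 𝔠, s * c = c * s := by
    rintro _ ⟨i, hi, rfl⟩ _ ⟨j, hj, rfl⟩
    exact hcomm0 S Sᶜ hSC i hi j hj
  have h𝔠P : ∀ B ∈ 𝔠, (∀ p ∈ H.piece 1 0, B p = 0) → (∀ v, B v ∈ H.piece 1 0) → B = 0 := by
    rcases horth 𝔠 𝔰₁ (hmaple Sᶜ) (hmaple S) (hst Sᶜ) (hst S) h𝔰₁conj (fun c hc s hs => (hcomm𝔰𝔠 s hs c hc).symm) with h | h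
    · exact h
    · exfalso
      exact hπs₀ (h _ hB₁mem (hπP _) (hπim _))
  -- the conjugate image of `𝔠`
  obtain ⟨𝔠b, h𝔠b⟩ : ∃ T : Submodule ℂ (Module.End ℂ (ℂ ⊗[ℚ] V)),
      ∀ C, C ∈ T ↔ ∃ B ∈ 𝔠, ∀ v, C v = conj (B (conj v)) := by
    refine ⟨{ carrier := {C | ∃ B ∈ 𝔠, ∀ v, C v = conj (B (conj v))}
              zero_mem' := ⟨0, Submodule.zero_mem _, fun v => by simp⟩
              add_mem' := ?_, smul_mem' := ?_ }, fun C => Iff.rfl⟩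
    · rintro C C' ⟨B, hB, hC⟩ ⟨B', hB', hC'⟩
      exact ⟨B + B', Submodule.add_mem _ hB hB', fun v => by
        rw [LinearMap.add_apply, hC, hC', LinearMap.add_apply, map_add]⟩
    · rintro c C ⟨B, hB, hC⟩
      exact ⟨(starRingEnd ℂ c) • B, Submodule.smul_mem _ _ hB, fun v => by
        rw [LinearMap.smul_apply, hC, LinearMap.smul_apply, conj_smul, starRingEnd_self_apply]⟩
  have h𝔠ble : 𝔠b ≤ H.hodgeLieC := fun C hC => by
    obtain ⟨B, hB, hCB⟩ := (h𝔠b C).1 hC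
    have hB' : B ∈ H.hodgeLieC := hmaple Sᶜ hB
    rw [hodgeLieC_eq_spanC] at hB' ⊢
    exact conjOp_mem_spanC hB' hCB
  have h𝔠bst : ∀ Y ∈ H.hodgeLieC, ∀ t ∈ 𝔠b, Y * t - t * Y ∈ 𝔠b := by
    intro Y hY C hC
    obtain ⟨B, hB, hCB⟩ := (h𝔠b C).1 hC
    obtain ⟨Yb, hYb⟩ := exists_conjOp Y
    have hYbM : Yb ∈ H.hodgeLieC := by rw [hodgeLieC_eq_spanC] at hY ⊢; exact conjOp_mem_spanC hY hYb
    refine (h𝔠b _).2 ⟨Yb * B - B * Yb, hst Sᶜ Yb hYbM B hB, fun v => ?_⟩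
    have hYbb : ∀ v, Y v = conj (Yb (conj v)) := fun v => by rw [hYb, conj_conj, conj_conj]
    rw [LinearMap.sub_apply, LinearMap.sub_apply, map_sub, ← hconj_mul hYbb hCB, ← hconj_mul hCB hYbb]
  have hcomm𝔠b : ∀ a ∈ 𝔠b, ∀ s ∈ 𝔰₁, a * s = s * a := by
    intro a ha s hs
    obtain ⟨c, hc, hac⟩ := (h𝔠b a).1 ha
    obtain ⟨sb, hsb⟩ := exists_conjOp s
    have hsb𝔰 : sb ∈ 𝔰₁ := h𝔰₁conj s hs sb hsb
    have hsbb : ∀ v, s v = conj (sb (conj v)) := fun v => by rw [hsb, conj_conj, conj_conj]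
    have h := hcomm𝔰𝔠 sb hsb𝔰 c hc
    refine LinearMap.ext fun v => ?_
    rw [← hconj_mul hac hsbb, ← hconj_mul hsbb hac, h]
  have h𝔠Q : ∀ C ∈ 𝔠, (∀ q ∈ H.piece 0 1, C q = 0) → (∀ v, C v ∈ H.piece 0 1) → C = 0 := by
    have hb : ∀ B ∈ 𝔠b, (∀ p ∈ H.piece 1 0, B p = 0) → (∀ v, B v ∈ H.piece 1 0) → B = 0 := by
      rcases horth 𝔠b 𝔰₁ h𝔠ble (hmaple S) h𝔠bst (hst S) h𝔰₁conj hcomm𝔠b with h | h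
      · exact h
      · exfalso
        exact hπs₀ (h _ hB₁mem (hπP _) (hπim _))
    intro C hC hCQ hCim
    obtain ⟨B, hB⟩ := exists_conjOp C
    obtain ⟨hBP, hBim, -, hconjB⟩ := SymplecticThetaTen.conjOp_raise (P := H.piece 0 1) (Q := H.piece 1 0)
      (fun x hx => conj_mem_piece H hx) (fun x hx => conj_mem_piece H hx) hCQ hCim hB
    have hB0 := hb B ((h𝔠b B).2 ⟨C, hC, hB⟩) hBP hBim
    refine LinearMap.ext fun v => ?_
    have h := hconjB v
    rw [hB0, LinearMap.zero_apply] at h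
    rw [LinearMap.zero_apply, ← conj_conj (C v), h, map_zero]
  have h𝔠Θ : ∀ c ∈ 𝔠, Θ * c = c * Θ := hcommΘ 𝔠 (fun Z hZ => hst Sᶜ Θ hΘM Z hZ) h𝔠P h𝔠Q
  -- assembling
  refine ⟨𝔰₁, 𝔠, hmaple S, hmaple Sᶜ, ?_, ?_, hst S, hst Sᶜ, hcomm𝔰𝔠, ?_, hmin, h𝔰₁conj, ?_, ?_, h𝔠Θ, ?_⟩
  · rw [eq_bot_iff]
    intro x hx
    obtain ⟨⟨i, hi, rfl⟩, ⟨j, hj, hji⟩⟩ := Submodule.mem_inf.1 hx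
    rw [Submodule.mem_bot]
    have hij : j = i := hΦinj hji
    subst hij
    have h : j ∈ S ⊓ Sᶜ := (LieSubmodule.mem_inf _ _ _).2 ⟨hi, hj⟩
    rw [hSC, LieSubmodule.mem_bot] at h
    rw [h, map_zero]
  · refine le_antisymm (sup_le (hmaple S) (hmaple Sᶜ)) fun Y hY => ?_
    obtain ⟨y, rfl⟩ := hΦsurj Y hY
    have hy : y ∈ S ⊔ Sᶜ := by rw [sup_compl_eq_top]; exact LieSubmodule.mem_top y
    obtain ⟨w, hw, c, hc, rfl⟩ := (LieSubmodule.mem_sup _ _ _).1 hy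
    rw [map_add]
    exact Submodule.add_mem_sup ⟨w, hw, rfl⟩ ⟨c, hc, rfl⟩
  · intro h
    rw [h] at hB₁mem
    exact hπs₀ ((Submodule.mem_bot ℂ).1 hB₁mem)
  · -- every raising operator is its own raising component, which lies in `𝔰₁`
    intro B hB hBP hBim
    obtain ⟨y, rfl⟩ := hΦsurj B hB
    have hy : y ∈ S ⊔ Sᶜ := by rw [sup_compl_eq_top]; exact LieSubmodule.mem_top y
    obtain ⟨w, hw, c, hc, rfl⟩ := (LieSubmodule.mem_sup _ _ _).1 hy
    have hπc : π (Φ c) = 0 := h𝔠P _ (hπmem Sᶜ _ ⟨c, hc, rfl⟩) (hπP _) (hπim _)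
    rw [← hπraise _ hBP hBim, map_add, map_add, hπc, add_zero]
    exact hπmem S _ ⟨w, hw, rfl⟩
  · -- lowering operators: conjugates of raising ones
    intro C hC hCQ hCim
    obtain ⟨B, hB⟩ := exists_conjOp C
    obtain ⟨hBP, hBim, -, hconjB⟩ := SymplecticThetaTen.conjOp_raise (P := H.piece 0 1) (Q := H.piece 1 0)
      (fun x hx => conj_mem_piece H hx) (fun x hx => conj_mem_piece H hx) hCQ hCim hB
    have hBM : B ∈ H.hodgeLieC := by rw [hodgeLieC_eq_spanC] at hC ⊢; exact conjOp_mem_spanC hC hB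
    obtain ⟨y, rfl⟩ := hΦsurj B hBM
    have hy : y ∈ S ⊔ Sᶜ := by rw [sup_compl_eq_top]; exact LieSubmodule.mem_top y
    obtain ⟨w, hw, c, hc, hwc⟩ := (LieSubmodule.mem_sup _ _ _).1 hy
    have hπc : π (Φ c) = 0 := h𝔠P _ (hπmem Sᶜ _ ⟨c, hc, rfl⟩) (hπP _) (hπim _)
    have hBs : Φ y ∈ 𝔰₁ := by
      rw [← hπraise _ hBP hBim, ← hwc, map_add, map_add, hπc, add_zero]
      exact hπmem S _ ⟨w, hw, rfl⟩
    exact h𝔰₁conj _ hBs C (fun v => by rw [hB, conj_conj, conj_conj])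
  · -- Jacobson
    rcases exists_ideal_finrank_eq_of_isSimple_ideal S Sᶜ inf_compl_eq_bot sup_compl_eq_top with hK | ⟨W, hWK, hWdim⟩
    · left
      rw [h𝔠, hK]
      simp
    · right
      refine ⟨W.toSubmodule.map Φ, Submodule.map_mono hWK, fun h => ?_, hst W, by rw [hfin W, hfin S, hWdim]⟩
      have hW0 := hmap0 W h
      rw [hW0] at hWdim
      have hS0 : Module.finrank ℂ S.toSubmodule = 0 := by rw [← hWdim]; simp
      have : S = ⊥ := by
        have h := Submodule.finrank_eq_zero.1 hS0
        rw [eq_bot_iff]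
        intro x hx
        rw [LieSubmodule.mem_bot]
        have := (Submodule.eq_bot_iff _).1 h x hx
        exact this
      exact hSatom.1 this

end HodgeStructure

end Literature.AlgebraicGeometry.Motives
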